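import Mathlib
import HarnessLib
import HarnessLib.Audit
import Summits.AtomisticToContinuum.Statement
import Summits.AtomisticToContinuum.Crystallization.Theorems.PalmUnimodularRigidityCrysPeriodicBddBelow

/-!
Route: OneGrainWindow

CLOSED (retired) 2026-08-15T13:45:05Z by operator:999:1257524 — reason: not-a-thesis: assembly does not conclude the sub-problem Statement — note: D-0027 §2.1 audit (human 2026-08-15: routes that do not decide the summit are removed): the assembly concludes `Literature.MathematicalPhysics.StatisticalMechanics.Crystallization`, not the sub-problem statement; a NEW conforming route may be opened from the same idea (generated `closes : … → _root_. The file is kept as the record of this route; refuted decls are indexed as negative knowledge (`ledger negatives`).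

# Route OneGrainWindow — one matched window per N is enough; LJ enters only through a finite-N
defect-counting coercivity

It suffices to show X = C ∧ G ∧ W (card one-grain-sbv-window, its P1/P2–P4 split made exact). C =
LjDefectCoercivity: there is ONE
periodic configuration P of ℝ³ such that for every environment radius R₁ and tolerance θ some κ > 0
satisfies, for EVERY finite
injective configuration x of N particles, 𝓔_LJ(x) ≥ N·e_LJ(P) + κ·#{i : the R₁-environment of x_i is
not θ-matched, both ways and up
to an isometry fixing x_i, to P − p₀ for some motif point p₀} (Theil's 2-D defect bound, asked of
Lennard-Jones in 3-D; it contains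
"P is the periodic minimiser" and stacking selection). G = OneGrainGluing (potential-free): beyond a
radius R₀(P), "fewer than N/M
unmatched particles" forces ONE particle whose radius-R window is ε-matched to P. W =
WindowsCrystallize (potential-free bookkeeping):
one matched window per large N plus uniform separation gives Blanc–Lewin (16) after a subsequence,
translations and an O(3) limit.
Lean: `LjDefectCoercivity ∧ OneGrainGluing ∧ WindowsCrystallize`

## Assembly
Elementary given the items (no new mathematics; LennardJonesMinimalDistance_holds and
LennardJonesGroundStatesExist_holds are theorems
of the tree). Energy: C with any (R₁, θ) gives N·e(P) ≤ 𝓔(x) for all injective x, hence e(P) ≤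
E(N)/N for N ≥ 1 (le_ciInf); 0714 +
0629 give limsup E(N)/N ≤ ⨅_Q e(Q) ≤ e(P) and E(N) ≤ 0 bounds the sequence, so E(N)/N → e(P) and
e(P) ≤ e(Q) for all Q: IsLeast, i.e.
HasPeriodicGroundStateEnergy. Positions: for ground states x^N, κ·#Bad_N ≤ E(N) − N·e(P) < N·κ/(M+1)
eventually, so M·#Bad_N < N and
G yields, for each (R, ε), eventually a matched window; W with δ = 1/3
(LennardJonesMinimalDistance_holds) gives the (16)-clause; the
two conjuncts are Crystallization by definition.

Rationale: WHY THIS LINE. Blanc–Lewin (16) (BlancLewin2015 §2.1) asks, along a subsequence WE choose, for ONE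
growing window per N — not for a vanishing defect
density w.r.t. a vertex-transitive crystal (contrast hinge 0751 of route CrystalKissingRigidity and
the refuter note on it). Read that
way, the positional conjunct needs from the physics only a COUNT of mismatched particles that is
o(N), and the count comes from a
finite-N inequality of Theil's shape (Theil2006: energy ≥ N·e* + c·#defects in d = 2;
FlatleyTheil2015 in d = 3 with a three-body
term) together with the trial bound limsup E(N)/N ≤ e(P) (0629): κ·#Bad ≤ E(N) − N·e(P) = o(N). The
card proposed SBV piecewise-rigidity
compactness (FriedrichKreutzSchmidt2021, Kreutz–Ziereis arXiv:2604.19239,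
ChambolleGiacominiPonsiglione2007) as the engine from
"coercivity + surface-scaling excess" to the window; at the FIXED radii that (16) needs, Chebyshev
counting plus a template-gluing lemma
from the crystallographers' local theory (DolbilinLagariasSenechal1998, Dolbilin2016,
DolbilinEtAl2021 — here with the template P GIVEN,
so far easier than the Local Theorem) already does it and needs only o(N) excess, no N^{2/3}.
Imported areas: discrete/variational
atomistic-to-continuum analysis (the defect-counting format), mathematical crystallography
(cluster/orbit stabilisation radii). The same
C gives the energetic conjunct at once (e(P) ≤ E(N)/N for all N, so P is least and E(N)/N → e(P)
with 0629/0714). No prior route types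
the local inequality: 0620 (CrystalLocalRigidity (a)) is informal; here it is one elaborated Prop
with no gauge, no e_loc and no Barlow
vocabulary — the gauge is a proof device, and with a non-local gauge allowed the pointwise and
summed forms are equivalent.

RANKED CRUXES. #2 LjDefectCoercivity (crux) — DEFECT-COUNTING COERCIVITY FOR LENNARD-JONES IN ℝ³
(card P1 in summed, gauge-free form). There is a periodic configuration P (lattice + finite motif;
expected relaxed hcp, but unnamed) such that for all R₁ > 0, θ > 0 there is κ > 0 with: for every N
and every injective x : Fin N → ℝ³, N·e_LJ(P) + κ·#Bad ≤ 𝓔_LJ(x), where i is Bad unless for some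
motif point p₀ and some linear isometry A every point p of P with |p − p₀| ≤ R₁ has a particle
within θ of x_i + A(p − p₀) and every particle within R₁ of x_i is within θ of x_i + A(p − p₀) for
some p ∈ P. Monotone in R₁ (larger radius = stronger); θ ≥ 2R₁ makes everyone good and the statement
reads e(P) ≤ 𝓔(x)/N. Contains: P minimises e_LJ over periodic configurations (with 0715-type
periodisation), uniqueness of the minimiser up to isometry at every finite resolution, strict
stacking selection (Hägg domination 0737 + certified couplings 0670 are the expected route to the
polytype part), and a uniform price for vacuum-adjacent, strained, grain-boundary and amorphous
particles. [difficulty: open-problem] (why it might fail: Asserts a UNIQUE periodic minimiser and a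
uniform price per mismatched particle over ALL finite configurations: dead if stacking selection
ties/fails (hcp–fcc gap ≈ 1e-4·|e*|, J₂ ≈ −7.3e-5 uncertified: 0670/0737) or polytetrahedral order
has excess/#Bad → 0; no 3-D pair analogue of Theil's bound.) [Theil2006, FlatleyTheil2015,
BlancLewin2015, Stillinger2001, SchwerdtfegerBurrowsSmits2021, LoachAckland2017,
PartayOrtnerCsanyi2017, Literature.Barriers.AtomisticToContinuum.IcosahedralClusters,
Literature.Barriers.AtomisticToContinuum.TetrahedralFrustration]
#3 OneGrainGluing (crux) — ONE-GRAIN GLUING (card P2–P4 at fixed radius; potential-free, every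
periodic P). For every periodic configuration P of ℝ³ there is R₀ such that for all R₁ ≥ R₀ and all
R, ε > 0 there are θ > 0 and M ∈ ℕ with: whenever a finite configuration x of N particles has
M·#Bad(R₁, θ) < N (Bad as in LjDefectCoercivity), some particle x_i carries a radius-R window
ε-matched both ways to x_i + A(P − p₀) for a motif point p₀ and a linear isometry A. Proof idea: a
Bad particle spoils ≤ M−1 good ones within R + 2R₁ (good particles are locally P-like, hence
uniformly discrete), so an unspoiled good particle exists; around it charts of radius R₁ are
extended shell by shell, consecutive charts agreeing on a ball of radius ≥ R₀ where approximate
cluster congruences of P are Cδ-close to exact symmetries of P (cluster-group and orbit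
stabilisation at finite radius, compactness of isometries, linear error growth), so 2R/R₁ steps cost
a factor C^{2R/R₁} absorbed into θ. Finite clusters are all-Bad (their rim sees missing points), so
#Bad = 0 forces N = 0, consistent. [difficulty: L] (why it might fail: Via typing: matching is
two-sided but multiplicity-blind, improper isometries and per-particle base points allowed; the
approximate-cluster-congruence ⇒ near-symmetry step with LINEAR error growth beyond a finite R₀(P)
is unprinted; below R₀ it is false (polytypes are first-shell-matched to hcp).)
[DolbilinLagariasSenechal1998, Dolbilin2016, DolbilinEtAl2021, Hales2012,
Literature.Barriers.AtomisticToContinuum.KissingTwelveDegeneracy]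
#9 WindowsCrystallize (support) — WINDOWS CRYSTALLIZE (the "one grain is enough" bookkeeping;
potential-free). If a sequence x^N of N-point configurations of ℝ³ is uniformly δ-separated and, for
every R, ε > 0, eventually in N some particle carries a radius-R window ε-matched both ways to x_i +
A_N(P − p₀) (P a fixed periodic configuration, p₀ ∈ motif, A_N a linear isometry), then the
convergence clause of IsCrystallizing holds for x: choose N_j ↑ with (R, ε) = (j, 1/j), τ_j =
−x_{i_j}, pass to a subsequence with constant p₀ (finite motif) and A_{N_j} → A in O(3) fast enough
that j·‖A_{N_j} − A‖ → 0, take P' = isometryImage A (translate (−p₀) P) and m ≡ 1; conclude with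
PeriodicConfiguration.tendsto_sum_of_eventually_near' (tree, CrystallizationLocalLimit) — separation
below min(δ, ρ_P)/3 makes the matching a bijection near supp f. [difficulty: provable-now]
[BlancLewin2015,
Literature.MathematicalPhysics.StatisticalMechanics.PeriodicConfiguration.tendsto_sum_of_eventually_near',
Literature.MathematicalPhysics.StatisticalMechanics.PeriodicConfiguration.isometryImage]
#9 CrysEnergyUpper (support) — shared item 0629 (route CrystalLocalRigidity): trial-state upper
bound limsup E(N)/N ≤ ⨅ over periodic Q of e_LJ(Q) (finite blocks of Q as trial states, boundary
O(N^{2/3}), r⁻⁶ tail summable in d = 3; with 0714 for ciInf). Only "∀ ε, eventually E(N)/N ≤ e(P) +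
ε" is used here (E(N) ≤ 0 bounds the sequence above). [difficulty: M] [BlancLewin2015, Theil2006]
#9 CrysPeriodicBddBelow (support) — shared item 0714 (route CrystalLocalRigidity): the LJ energy per
particle of periodic configurations of ℝ³ is bounded below (stability constant; makes ⨅_Q e(Q) a
genuine infimum, ciInf_le). [difficulty: M] [BlancLewin2015]

TWO-LAYER PLAN. Foreseen once LjDefectCoercivity is under attack (k ≤ 3, depth 1, nothing filed
now): LjDefectCoercivity ⇐ BarlowTierCoercivity →
StackingTierCoercivity → LjDefectCoercivity, where tier 1 prices (κ₁ per particle) every particle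
whose two-shell environment is θ-far
from ALL relaxed Barlow-stacking environments (Flyspeck-type certificate with finite-range
transfers; cards
equality-free-certificates-phonon-near-field, frustration-range-lp-hierarchy) and tier 2 prices (κ₂
≈ fault cost / R₁) every
Barlow-matched particle that is not P-matched (Hägg domination 0737 + certified interlayer couplings
0670); glue: Bad_P ⊆ Bad_Barlow ∪
(Barlow ∖ P). OneGrainGluing ⇐ ClusterRigidity (approximate cluster congruences of P beyond R₀ are
Cδ-close to symmetries of P) →
ChartExtension (shell-by-shell continuation with linear error growth) → OneGrainGluing.

KILL CRITERIA. ¬LjDefectCoercivity by an explicit competitor family — two non-isometric periodic LJ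
minimisers (e.g. a certified tie e(fcc) = e(hcp)
or an optimal longer polytype degenerate with hcp), an aperiodic optimal stacking (then 0668 of
RefuteCrystalPeriodicMin also fires and
the conjunct itself dies), or polytetrahedral configurations with (𝓔 − N·e(P))/#Bad → 0 — closes the
route `refuted:LjDefectCoercivity`;
if the witness is only a FINITE set of isometry classes of minimisers, pivot (restate C and G over a
finite template family {P₁,…,P_k},
W unchanged). ¬OneGrainGluing as typed ⇒ restate (it is a geometric lemma; a counterexample can only
exploit the typing). BulkDefectVanish
(0751) + 0752 proved elsewhere do not moot the route (C is still the open physics); Crystallization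
refuted via 0668 moots it.

NOT DECOMPOSED YET. The constants κ(R₁, θ) (expected scale min{K θ²/R₁², g_fault/R₁} with g_fault ≈
6·10⁻⁵) and the transfer/gauge format of a proof
of C; the identity of P (hcp vs relaxed hcp vs polytype is irrelevant to the assembly); the card's
original SBV engine — the
MESOSCALE strengthening "grains of ≍ N^{1/3} atoms with a common orientation" via piecewise rigidity
(ChambolleGiacominiPonsiglione2007,
FriedrichKreutzSchmidt2021, arXiv:2604.19239) is true-looking and prettier but not needed for (16)
and not typable without SBV in
Mathlib; the explicit R₀(P) (cluster-group/orbit stabilisation radii) inside G;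
rotations/reflections bookkeeping inside W.

CHEAPEST FALSIFIER. (i) Certified lattice sums: e_LJ(relaxed hcp) < e_LJ(relaxed fcc), e_LJ(dhcp),
e_LJ(9R) with a margin (Stillinger2001 and
SchwerdtfegerBurrowsSmits2021 report hcp below fcc by ≈ 1e-4 relative; a certified TIE kills C as
typed). (ii) Toy kit run a refuter
can do first: for the putative LJ global minima N ≤ 150 (Cambridge Cluster Database) and for
fcc/hcp/icosahedral/decahedral motifs up
to N ≈ 10⁴, tabulate (𝓔(x) − N·e(hcp))/#Bad(R₁ = 1.7, θ = 0.1): C predicts a positive floor; magic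
icosahedra (13, 55, 147, 309, …)
are all-Bad with excess/N ≈ E(N)/N − e* > 0, so the stress cases are large decahedral/fcc-twinned
clusters where #Bad ≍ twin area.
(iii) For G: search small periodic P (e.g. dhcp) for pseudo-symmetric clusters persisting to large
radius — excluded by orbit
stabilisation, so only a typing slip can show up. Not run here (compute-free hub; no kit job
submitted at open).

NUMBERS. V_LJ = r⁻¹²/12 − r⁻⁶/6, min −1/12 at r = 1; e* ≈ −8.61/12 ≈ −0.72 per particle (hcp/fcc
lattice sums, Stillinger2001; hcp lower by
≈ 0.01 %); interlayer coupling J₂ ≈ −7.3e-5, |J₂|/Σ_{k≥3} k|J_k| ≈ 250 (route-internal numerics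
behind 0670, uncertified); fault cost per
column ≈ 6.4e-5 (card); LJ₁₃ icosahedron 𝓔 < −3.677 (IcosahedralClusters_holds) i.e. excess per
particle ≈ +0.43 over e*; uniform
minimal distance δ = 1/3 in LJ ground states (LennardJonesMinimalDistance_holds); regularity radius
of Delone sets in ℝ³ ≤ 10R
(DolbilinEtAl2021), the scale of R₀(P) in G. Items at open: 6 (2 cruxes, 3 support, 1 assembly).

DEFINITION REQUESTS. None needed to elaborate: the two-sided window-matching predicate is inlined as
a `let W := …` in C and G and written out in W
(same text). A Literature-level `PeriodicConfiguration.WindowMatched P R ε x i p₀ A` in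
CrystallizationLocalLimit.lean would shorten
all three and 0751/0752/0759 of CrystalKissingRigidity; not filed now to keep the items elaborating
today.

Novelty: Searches (2026-08-15): crossref "Delone set local rules regularity radius crystal clusters
congruent" (15: Dolbilin2016,
DolbilinEtAl2021, Dolbilin 2025 doi:10.1134/s199508022560551x); crossref "crystallization energy
minimizers defects estimate surface
scaling local rigidity three dimensions" (15, none on point); crossref "Multiregular point systems"
(DolbilinLagariasSenechal1998);
lit galaxy search --star pdf "crystallization conjecture" (11: Cotar–Petrache arXiv:1707.07664,
Bétermin hal-01400869, Kubin–Ponsiglione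
arXiv:2004.06820, OWR 2018/49 READ — all finite/positional crystallization results there are 2-D);
galaxy all/pdf exact phrases
"crystallization in three dimensions Lennard-Jones", "face-centered cubic crystallization of
atomistic configurations" (0); local
FTS / OpenAlex / arXiv tiers unavailable today (reset / HTTP 429); plus the card's audit
(arXiv:2604.19239 read pp. 1–2, 35;
FriedrichKreutzSchmidt2021; ChambolleGiacominiPonsiglione2007) and the sub's three route files, 108
cards, negatives index (empty).
Nearest prior art found: Theil2006 (d = 2: the defect-counting energy bound and its use for Thm
1.2/1.3), FlatleyTheil2015
(arXiv:1407.0692, d = 3 with a three-body term, energy statement), FriedrichKreutzSchmidt2021 +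
Kreutz–Ziereis arXiv:2604.19239
(polycrystal compactness from surface-scaling excess, rigid cells put in by hand),
DolbilinLagariasSenechal1998 / DolbilinEtAl2021
(local criteria and regularity radii for Delone sets), BlancLewin2015 §2.1 (16)  [refs: 10.1134/s199508022560551x, 1707.07664, 2004.06820, 2604.19239, 1407.0692, doi:10.1134/s199508022560551x, Dolbilin2016, DolbilinEtAl2021, DolbilinLagariasSenechal1998, FriedrichKreutzSchmidt2021, ChambolleGiacominiPonsiglione2007, Theil2006, FlatleyTheil2015, BlancLewin2015]

Barriers (technique_class: local-energy-inequality defect-counting template-gluing): - technique_class: local-energy-inequality defect-counting template-gluing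
- Literature.Barriers.AtomisticToContinuum.IcosahedralClusters: evaded by the assembly — no finite-N
exactness; LJ₁₃-type clusters are all-Bad and pay excess ≈ 0.43 per particle, consistent with C; it
constrains only HOW C is proved (no first-shell pointwise inequality can hold), declared in C's
why-might-fail.
- Literature.Barriers.AtomisticToContinuum.TetrahedralFrustration: applies to any proof of C by pure
Voronoi/Delaunay local bounds; the bet is a hybrid certificate with transfers of range ≥ 2 shells
(tier split in the two-layer plan); G and W are untouched.
- Literature.Barriers.AtomisticToContinuum.KissingTwelveDegeneracy: respected — C quantifies over
every radius R₁, so the stacking is selected inside C by the tail (Hägg domination 0737 + 0670),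
never by contacts; G is claimed only beyond R₀(P), where polytypes are told apart.
- Literature.Barriers.AtomisticToContinuum.ShortRangeStackingBlindness: same point — nothing here
truncates V_LJ; C at R₁ > √(8/3) sees the third shell.
- Literature.Barriers.AtomisticToContinuum.FlexibleKissingArrangements: not met by G (template P
given, two-sided matching at radius ≥ R₀(P) ≫ first shell); it bites only a first-shell attempt at
C.
- Literature.Barriers.AtomisticToContinuum.LocalizedPotentialsExcludeLennardJones: the route takes
from Theil/FKS only the potential-independent half (counting + gluing + (16) bookkeeping); C is
stated for true LJ with no na

History (route lifecycle, newest last):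
- 2026-08-15T13:19:32Z · BROKEN — OneGrainGluing (stmt-AtomisticToContinuum-3506, crux) refuted by Summit.AtomisticToContinuum.Crystallization.Theorems.OneGrainWindowOneGrainGluing_refuted @ d3a8e91526cb (refuter-rreview-route-Schanuel-ExpMordel-ca79690f-0)
- 2026-08-15T13:45:05Z · CLOSED retired — not-a-thesis: assembly does not conclude the sub-problem Statement (operator:999:1257524)

sub-problem: Crystallization · status: closed(retired) · opened planner-plancard-AtomisticToContinuum-Crystal-f8ad38a7-0 2026-08-15T11:19:10Z · rev 0 · ledger route-AtomisticToContinuum-OneGrainWindow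
GENERATED by the gate from the ledger (D-0016/17). Provers cite these decls: `theorem foo : Summit.AtomisticToContinuum.Crystallization.Theses.OneGrainWindow.<Decl> := …` in Summits/AtomisticToContinuum/Crystallization/Theorems/<Name>.lean.
-/

namespace Summit.AtomisticToContinuum.Crystallization.Theses.OneGrainWindow

open scoped BigOperators Topology Manifold Classical MeasureTheory ProbabilityTheory Matrix InnerProductSpace ComplexConjugate ContinuousMap
open Filter Set Function TopologicalSpace MeasureTheory

attribute [summit_statement] _root_.Crystallization

/-- item stmt-AtomisticToContinuum-3505 · crux · rank 2 · closed · moot by None · by planner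
why it might fail: Asserts a UNIQUE periodic minimiser and a uniform price per mismatched particle over ALL finite configurations: dead if stacking selection ties/fails (hcp–fcc gap ≈ 1e-4·|e*|, J₂ ≈ −7.3e-5 uncertified: 0670/0737) or polytetrahedral order has excess/#Bad → 0; no 3-D pair analogue of Theil's bound.
sources: Theil2006, FlatleyTheil2015, BlancLewin2015, Stillinger2001, SchwerdtfegerBurrowsSmits2021, LoachAckland2017
[crux] DEFECT-COUNTING COERCIVITY FOR LENNARD-JONES IN ℝ³ (card P1 in summed, gauge-free form).
There is a periodic configuration P (lattice + finite motif; expected relaxed hcp, but unnamed) such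
that for all R₁ > 0, θ > 0 there is κ > 0 with: for every N and every injective x : Fin N → ℝ³,
N·e_LJ(P) + κ·#Bad ≤ 𝓔_LJ(x), where i is Bad unless for some motif point p₀ and some linear isometry
A every point p of P with |p − p₀| ≤ R₁ has a particle within θ of x_i + A(p − p₀) and every
particle within R₁ of x_i is within θ of x_i + A(p − p₀) for some p ∈ P. Monotone in R₁ (larger
radius = stronger); θ ≥ 2R₁ makes everyone good and the statement reads e(P) ≤ 𝓔(x)/N. Contains: P
minimises e_LJ over periodic configurations (with 0715-type periodisation), uniqueness of the
minimiser up to isometry at every finite resolution, strict stacking selection (Hägg domination 0737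
+ certified couplings 0670 are the expected route to the polytype part), and a uniform price for
vacuum-adjacent, strained, grain-boundary and amorphous particles. [difficulty: open-problem] -/
@[route_item "route-AtomisticToContinuum-OneGrainWindow"]
def LjDefectCoercivity : Prop :=
  ∃ P : Literature.MathematicalPhysics.StatisticalMechanics.PeriodicConfiguration 3, ∀ R₁ θ : ℝ, 0 < R₁ → 0 < θ → ∃ κ : ℝ, 0 < κ ∧ ∀ (N : ℕ) (x : Fin N → EuclideanSpace ℝ (Fin 3)), Function.Injective x → let W : ℝ → ℝ → Fin N → EuclideanSpace ℝ (Fin 3) → (EuclideanSpace ℝ (Fin 3) ≃ₗᵢ[ℝ] EuclideanSpace ℝ (Fin 3)) → Prop := fun ρ η i p₀ A => (∀ p ∈ P.points, dist p p₀ ≤ ρ → ∃ j : Fin N, dist (x j) (x i + A (p - p₀)) ≤ η) ∧ (∀ j : Fin N, dist (x j) (x i) ≤ ρ → ∃ p ∈ P.points, dist (x j) (x i + A (p - p₀)) ≤ η); (N : ℝ) * P.energyPerParticle Literature.MathematicalPhysics.StatisticalMechanics.lennardJones + κ * (Nat.card {i : Fin N // ¬ ∃ p₀ ∈ P.motif,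 ∃ A : EuclideanSpace ℝ (Fin 3) ≃ₗᵢ[ℝ] EuclideanSpace ℝ (Fin 3), W R₁ θ i p₀ A} : ℝ) ≤ Literature.MathematicalPhysics.StatisticalMechanics.interactionEnergy Literature.MathematicalPhysics.StatisticalMechanics.lennardJones x

/-- item stmt-AtomisticToContinuum-3506 · crux · rank 3 · closed · refuted by Summit.AtomisticToContinuum.Crystallization.Theorems.OneGrainWindowOneGrainGluing_refuted @ d3a8e91526cb (refuter) · by planner
why it might fail: Via typing: matching is two-sided but multiplicity-blind, improper isometries and per-particle base points allowed; the approximate-cluster-congruence ⇒ near-symmetry step with LINEAR error growth beyond a finite R₀(P) is unprinted; below R₀ it is false (polytypes are first-shell-matched to hcp).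
sources: DolbilinLagariasSenechal1998, Dolbilin2016, DolbilinEtAl2021, Hales2012, Literature.Barriers.AtomisticToContinuum.KissingTwelveDegeneracy
[crux] ONE-GRAIN GLUING (card P2–P4 at fixed radius; potential-free, every periodic P). For every
periodic configuration P of ℝ³ there is R₀ such that for all R₁ ≥ R₀ and all R, ε > 0 there are θ >
0 and M ∈ ℕ with: whenever a finite configuration x of N particles has M·#Bad(R₁, θ) < N (Bad as in
LjDefectCoercivity), some particle x_i carries a radius-R window ε-matched both ways to x_i + A(P −
p₀) for a motif point p₀ and a linear isometry A. Proof idea: a Bad particle spoils ≤ M−1 good ones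
within R + 2R₁ (good particles are locally P-like, hence uniformly discrete), so an unspoiled good
particle exists; around it charts of radius R₁ are extended shell by shell, consecutive charts
agreeing on a ball of radius ≥ R₀ where approximate cluster congruences of P are Cδ-close to exact
symmetries of P (cluster-group and orbit stabilisation at finite radius, compactness of isometries,
linear error growth), so 2R/R₁ steps cost a factor C^{2R/R₁} absorbed into θ. Finite clusters are
all-Bad (their rim sees missing points), so #Bad = 0 forces N = 0, consistent. [difficulty: L] -/
@[route_item "route-AtomisticToContinuum-OneGrainWindow"]
def OneGrainGluing : Prop :=
  ∀ P : Literature.MathematicalPhysics.StatisticalMechanics.PeriodicConfiguration 3, ∃ R₀ : ℝ, ∀ R₁ : ℝ, R₀ ≤ R₁ → ∀ R ε : ℝ, 0 < R → 0 < ε → ∃ θ : ℝ, 0 < θ ∧ ∃ M : ℕ, ∀ (N : ℕ) (x : Fin N → EuclideanSpace ℝ (Fin 3)), let W : ℝ → ℝ → Fin N → EuclideanSpace ℝ (Fin 3) → (EuclideanSpace ℝ (Fin 3) ≃ₗᵢ[ℝ] EuclideanSpace ℝ (Fin 3)) → Prop := fun ρ η i p₀ A => (∀ p ∈ P.points, dist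 p p₀ ≤ ρ → ∃ j : Fin N, dist (x j) (x i + A (p - p₀)) ≤ η) ∧ (∀ j : Fin N, dist (x j) (x i) ≤ ρ → ∃ p ∈ P.points, dist (x j) (x i + A (p - p₀)) ≤ η); M * Nat.card {i : Fin N // ¬ ∃ p₀ ∈ P.motif, ∃ A : EuclideanSpace ℝ (Fin 3) ≃ₗᵢ[ℝ] EuclideanSpace ℝ (Fin 3), W R₁ θ i p₀ A} < N → ∃ i : Fin N, ∃ p₀ ∈ P.motif, ∃ A : EuclideanSpace ℝ (Fin 3) ≃ₗᵢ[ℝ] EuclideanSpace ℝ (Fin 3), W R ε i p₀ A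

/-- item stmt-AtomisticToContinuum-0629 · support · rank 9 · closed · moot by None · by planner
sources: BlancLewin2015, Theil2006
Easy half of energetic crystallization: limsup E(N)/N ≤ ⨅ over periodic configurations of the LJ
energy per particle (finite blocks of a near-optimal periodic configuration as trial states;
boundary O(N^{2/3}); r⁻⁶ tail summable in d = 3; needs BddBelow of the range, from LJ stability). -/
@[route_item "route-AtomisticToContinuum-OneGrainWindow"]
def CrysEnergyUpper : Prop :=
  Filter.limsup (fun N : ℕ => Literature.MathematicalPhysics.StatisticalMechanics.groundStateEnergy Literature.MathematicalPhysics.StatisticalMechanics.lennardJones 3 N / N) Filter.atTop ≤ ⨅ Q : Literature.MathematicalPhysics.StatisticalMechanics.PeriodicConfiguration 3, Q.energyPerParticle Literature.MathematicalPhysics.StatisticalMechanics.lennardJones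

/-- item stmt-AtomisticToContinuum-0714 · support · rank 9 · closed · proved by Summit.AtomisticToContinuum.Crystallization.Theorems.crysPeriodicBddBelow_proof (prover) · by planner
sources: BlancLewin2015
The Lennard-Jones energy per particle of periodic configurations of ℝ³ (any full-rank lattice, any
finite motif) is bounded below (by −B, the stability constant: finite blocks of Q as N-point
configurations, boundary O(N^{2/3}), r⁻⁶ tail summable in d = 3). Makes ⨅_Q e(Q) a genuine infimum
(ciInf_le usable) in 0626/0629 and in the periodisation lemma. -/
@[route_item "route-AtomisticToContinuum-OneGrainWindow"]
def CrysPeriodicBddBelow : Prop :=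
  BddBelow (Set.range fun Q : Literature.MathematicalPhysics.StatisticalMechanics.PeriodicConfiguration 3 => Q.energyPerParticle Literature.MathematicalPhysics.StatisticalMechanics.lennardJones)

/-- item stmt-AtomisticToContinuum-3507 · support · rank 9 · closed · moot by None · by planner
sources: BlancLewin2015, Literature.MathematicalPhysics.StatisticalMechanics.PeriodicConfiguration.tendsto_sum_of_eventually_near', Literature.MathematicalPhysics.StatisticalMechanics.PeriodicConfiguration.isometryImage
[support] WINDOWS CRYSTALLIZE (the "one grain is enough" bookkeeping; potential-free). If a sequence
x^N of N-point configurations of ℝ³ is uniformly δ-separated and, for every R, ε > 0, eventually in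
N some particle carries a radius-R window ε-matched both ways to x_i + A_N(P − p₀) (P a fixed
periodic configuration, p₀ ∈ motif, A_N a linear isometry), then the convergence clause of
IsCrystallizing holds for x: choose N_j ↑ with (R, ε) = (j, 1/j), τ_j = −x_{i_j}, pass to a
subsequence with constant p₀ (finite motif) and A_{N_j} → A in O(3) fast enough that j·‖A_{N_j} − A‖
→ 0, take P' = isometryImage A (translate (−p₀) P) and m ≡ 1; conclude with
PeriodicConfiguration.tendsto_sum_of_eventually_near' (tree, CrystallizationLocalLimit) — separation
below min(δ, ρ_P)/3 makes the matching a bijection near supp f. [difficulty: provable-now] -/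
@[route_item "route-AtomisticToContinuum-OneGrainWindow"]
def WindowsCrystallize : Prop :=
  ∀ (P : Literature.MathematicalPhysics.StatisticalMechanics.PeriodicConfiguration 3) (x : (N : ℕ) → (Fin N → EuclideanSpace ℝ (Fin 3))), (∃ δ : ℝ, 0 < δ ∧ ∀ (N : ℕ) (i j : Fin N), i ≠ j → δ ≤ dist (x N i) (x N j)) → (∀ R ε : ℝ, 0 < R → 0 < ε → ∀ᶠ N in Filter.atTop, ∃ i : Fin N, ∃ p₀ ∈ P.motif, ∃ A : EuclideanSpace ℝ (Fin 3) ≃ₗᵢ[ℝ] EuclideanSpace ℝ (Fin 3), (∀ p ∈ P.points, dist p p₀ ≤ R → ∃ j : Fin N, dist (x N j) (x N i + A (p - p₀)) ≤ ε) ∧ (∀ j : Fin N, dist (x N j) (x N i) ≤ R → ∃ p ∈ P.points, dist (x N j) (x N i + A (p - p₀)) ≤ ε)) → ∃ (φ : ℕ → ℕ) (τ : ℕ → EuclideanSpace ℝ (Fin 3)) (P' : Literature.MathematicalPhysics.StatisticalMechanics.PeriodicConfiguration 3) (m : EuclideanSpace ℝ (Fin 3) → ℕ), StrictMono φ ∧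 (∀ s ∈ P'.points, 1 ≤ m s) ∧ (∀ g ∈ P'.lattice, ∀ s, m (s + g) = m s) ∧ ∀ f : EuclideanSpace ℝ (Fin 3) → ℝ, Continuous f → HasCompactSupport f → Filter.Tendsto (fun j => ∑ i : Fin (φ j), f (x (φ j) i + τ j)) Filter.atTop (nhds (∑' s : P'.points, (m s : ℝ) * f s))

/-- item stmt-AtomisticToContinuum-3508 · assembly · rank 1 · closed · moot by None · by planner
sources: BlancLewin2015
[assembly] LjDefectCoercivity → OneGrainGluing → WindowsCrystallize → CrysEnergyUpper →
CrysPeriodicBddBelow → Crystallization (LJ, d = 3). -/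
@[route_item "route-AtomisticToContinuum-OneGrainWindow"]
def Assembly : Prop :=
  LjDefectCoercivity → OneGrainGluing → WindowsCrystallize → CrysEnergyUpper → CrysPeriodicBddBelow → Literature.MathematicalPhysics.StatisticalMechanics.Crystallization

end Summit.AtomisticToContinuum.Crystallization.Theses.OneGrainWindow
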